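import Summits.NavierStokesRegularity.NavierStokesRegularity.Theorems.StrainDoorsNearRecordTimeRegularity
import Literature.Analysis.FluidPDE.KNSSThm52Integrand
import HarnessLib

/-!
# StrainDoorsNearRecordClockBounds — PART M §M11 (landing split): uniform frozen-point clock bounds in the Type-I class

(S-lane landing file: the author's window block of `typeI_nearRecord_clock_rate`, hoisted into the standalone lemma
`typeI_frozenPoint_clock_bounds` so that the ★★★ theorem's file (`StrainDoorsNearRecordClockRate`) meets the 400-line cap;
text of nsreg-p1 g36 r63/StrainDoorsNearRecordClockRate.lean sha256 eef3c1babb00a640, l.366–380 + l.450–722 verbatim up to the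
substitution `nsRescale lam u ↦ v`; statement shape per the LEAD ruling 08:34Z; hand ns-s29-p2 g6.)

See `StrainDoorsNearRecordTimeRegularity` (the §M11 tools) and `StrainDoorsNearRecordClockRate` (the ★★★ clock law with a
rate) for the round's mathematics; this file only isolates the uniform window estimates of the author's proof.
-/

noncomputable section

open MeasureTheory Set Function Filter Metric Real InnerProductSpace
open _root_.Topology
open scoped ENNReal NNReal RealInnerProductSpace ContDiff Laplacian
open Literature.Analysis Literature.Analysis.FluidPDE
open Literature.Analysis.FluidPDE.VorticityDirectionDynamics

set_option linter.dupNamespace false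
set_option maxSynthPendingDepth 3

namespace Summit.NavierStokesRegularity.NavierStokesRegularity.Theorems.StrainDoors

open Summit.NavierStokesRegularity.NavierStokesRegularity.Theorems.ArgmaxDoors

/-! ## §M11 (landing split) Uniform frozen-point clock bounds -/

set_option maxHeartbeats 400000 in
/-- **Uniform bounds for the frozen-point clock of a Type-I solution** (the window block of the author's proof of
`typeI_nearRecord_clock_rate`, hoisted so that each tree file stays under the 400-line cap; statement shape per the
LEAD ruling 2026-08-29T08:34Z).  For every `C₀ ≥ 0` there are `LΓ, CΓ ≥ 0` such that for every classical Type-I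
solution `v` on `(−∞,0) × ℝ³` with constant `C₀` and every point `z`, the frozen-point clock
`Γ(s) = −2(0 − s)|ω(s,z)|² + (0 − s)²·2⟪ω(s,z), (Δω − ∇ω·v + ∇v·ω)(s,z)⟫` satisfies `|Γ(s) − Γ(−1)| ≤ LΓ|s + 1|` on
`|s + 1| ≤ ½` and `|Γ(−1)| ≤ CΓ` (uniform space bounds of orders `≤ 3` and uniform time-Lipschitz bounds of orders
`≤ 3`, `exists_uniform_timeLipschitz`).  No rescaling inside: the class is scale invariant. [folklore-typed; text =
nsreg-p1 g36 r63/StrainDoorsNearRecordClockRate.lean eef3c1babb00a640 l.366–380 + l.450–722 with `nsRescale lam u ↦ v`] -/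
theorem typeI_frozenPoint_clock_bounds {C₀ : ℝ} (hC₀ : 0 ≤ C₀) :
    ∃ LΓ CΓ : ℝ, 0 ≤ LΓ ∧ 0 ≤ CΓ ∧
      ∀ (v : ℝ → (EuclideanSpace ℝ (Fin 3)) → (EuclideanSpace ℝ (Fin 3))) (q : ℝ → (EuclideanSpace ℝ (Fin 3)) → ℝ)
        (z : EuclideanSpace ℝ (Fin 3)),
        IsClassicalNSSolutionOn (Iio 0) 1 0 v q → HasTypeIDecay C₀ v →
        (∀ s : ℝ, |s - (-1)| ≤ 1 / 2 →
          |(-(2 * (0 - s)) * ‖curl (v s) z‖ ^ 2 + (0 - s) ^ 2 * (2 * ⟪curl (v s) z,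
              (Δ (curl (v s))) z - fderiv ℝ (curl (v s)) z (v s z) + fderiv ℝ (v s) z (curl (v s) z)⟫)) -
            (-(2 * (0 - (-1))) * ‖curl (v (-1)) z‖ ^ 2 + (0 - (-1)) ^ 2 * (2 * ⟪curl (v (-1)) z,
              (Δ (curl (v (-1)))) z - fderiv ℝ (curl (v (-1))) z (v (-1) z) +
                fderiv ℝ (v (-1)) z (curl (v (-1)) z)⟫))| ≤ LΓ * |s - (-1)|) ∧
        |-(2 * (0 - (-1))) * ‖curl (v (-1)) z‖ ^ 2 + (0 - (-1)) ^ 2 * (2 * ⟪curl (v (-1)) z,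
            (Δ (curl (v (-1)))) z - fderiv ℝ (curl (v (-1))) z (v (-1) z) +
              fderiv ℝ (v (-1)) z (curl (v (-1)) z)⟫)| ≤ CΓ := by
  obtain ⟨K, L₀, hK, hL₀, hKL⟩ := ChaeWolf.exists_uniform_lipschitz hC₀
  obtain ⟨K₂', K₃', hK₂', hK₃', hH⟩ := exists_uniform_hessLipschitz hC₀
  obtain ⟨K₃, hK₃, hD3⟩ := exists_uniform_D3Bound hC₀
  obtain ⟨L, hL, hTL⟩ := exists_uniform_timeLipschitz hC₀
  obtain ⟨c, hc⟩ : ∃ c : ℝ, c = ‖(curlCLM : ((EuclideanSpace ℝ (Fin 3)) →L[ℝ] (EuclideanSpace ℝ (Fin 3))) →L[ℝ]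
      (EuclideanSpace ℝ (Fin 3)))‖ := ⟨_, rfl⟩
  have hc0 : 0 ≤ c := by rw [hc]; exact norm_nonneg _
  obtain ⟨M₀, hM₀⟩ : ∃ M₀ : ℝ, M₀ = c * K := ⟨_, rfl⟩
  have hM₀0 : 0 ≤ M₀ := by rw [hM₀]; positivity
  obtain ⟨V₀, hV₀⟩ : ∃ V₀ : ℝ, V₀ = 12 * K₃ + c * K₂' * (2 * C₀) + K * M₀ := ⟨_, rfl⟩
  have hV₀0 : 0 ≤ V₀ := by rw [hV₀]; positivity
  obtain ⟨LV, hLV⟩ : ∃ LV : ℝ,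
      LV = 12 * L + (c * L * (2 * C₀) + c * K₂' * L) + (L * M₀ + K * (c * L)) := ⟨_, rfl⟩
  have hLV0 : 0 ≤ LV := by rw [hLV]; positivity
  obtain ⟨LΓ, hLΓ⟩ : ∃ LΓ : ℝ, LΓ = 2 * (M₀ ^ 2 + 2 * M₀ * (c * L)) +
      2 * ((5 / 2) * (M₀ * V₀) + (c * L * V₀ + M₀ * LV)) := ⟨_, rfl⟩
  have hLΓ0 : 0 ≤ LΓ := by rw [hLΓ]; positivity
  obtain ⟨CΓ, hCΓ⟩ : ∃ CΓ : ℝ, CΓ = 2 * M₀ ^ 2 + 2 * (M₀ * V₀) := ⟨_, rfl⟩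
  have hCΓ0 : 0 ≤ CΓ := by rw [hCΓ]; positivity
  refine ⟨LΓ, CΓ, hLΓ0, hCΓ0, fun v q z hcl hI' => ?_⟩
  -- the frozen-point time functions
  obtain ⟨w, hω⟩ : ∃ w : ℝ → EuclideanSpace ℝ (Fin 3), w = fun s => curl (v s) z := ⟨_, rfl⟩
  obtain ⟨V, hV⟩ : ∃ V : ℝ → EuclideanSpace ℝ (Fin 3),
      V = fun s => (Δ (curl (v s))) z - fderiv ℝ (curl (v s)) z (v s z) + fderiv ℝ (v s) z (curl (v s) z) :=
    ⟨_, rfl⟩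
  obtain ⟨Γ, hΓdef⟩ : ∃ Γ : ℝ → ℝ,
      Γ = fun s => -(2 * (0 - s)) * ‖w s‖ ^ 2 + (0 - s) ^ 2 * (2 * ⟪w s, V s⟫) := ⟨_, rfl⟩
  have hVval : ∀ s : ℝ, s < 0 → V s = (Δ (curl (v s))) z -
      fderiv ℝ (curl (v s)) z (v s z) +
      fderiv ℝ (v s) z (curl (v s) z) := fun s hs => by
    rw [hV]
  -- UNIFORM BOUNDS on the window `|s + 1| ≤ 1/2`
  have hwin : ∀ s : ℝ, |s - (-1)| ≤ 1 / 2 → s ≤ -(1 / 4 : ℝ) ∧ s < 0 ∧ 1 / 2 ≤ 0 - s ∧ 0 - s ≤ 3 / 2 :=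
    fun s hs => by
      have h1 := (abs_le.1 hs).1; have h2 := (abs_le.1 hs).2
      exact ⟨by linarith, by linarith, by linarith, by linarith⟩
  have h1' : |(-1:ℝ) - (-1)| ≤ 1 / 2 := by norm_num
  have h1e : (-1:ℝ) = -1 := rfl
  -- slice regularity of the rescaled solution and the symmetric time-Lipschitz bound on the window
  have hcd : ∀ s : ℝ, s < 0 → ContDiff ℝ ∞ (v s) := fun s hs =>
    hcl.contDiff_velocity (show s ∈ Iio (0:ℝ) from hs)
  have hHd : ∀ s : ℝ, s < 0 → ∀ y, HasFDerivAt (fderiv ℝ (v s))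
      (fderiv ℝ (fderiv ℝ (v s)) y) y := fun s hs y =>
    ((((hcd s hs).fderiv_right (m := 1) (by norm_cast)).differentiable (by norm_cast)) y).hasFDerivAt
  have hDcurl : ∀ s : ℝ, s < 0 → fderiv ℝ (curl (v s)) z =
      curlCLM.comp (fderiv ℝ (fderiv ℝ (v s)) z) := fun s hs =>
    (hasFDerivAt_curl_of_hasFDerivAt_fderiv (hHd s hs z)).fderiv
  have hTL' : ∀ τ σ : ℝ, |τ - (-1)| ≤ 1 / 2 → σ = -1 → ∀ k < 4,
      ‖iteratedFDeriv ℝ k (v τ) z - iteratedFDeriv ℝ k (v σ) z‖ ≤ L * |τ - σ| := by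
    intro τ σ hτ hσ k hk
    subst hσ
    have hτ1 := (abs_le.1 hτ).1; have hτ2 := (abs_le.1 hτ).2
    rcases le_total (-1 : ℝ) τ with hle | hle
    · exact hTL hcl hI' τ (by linarith) (-1) (by linarith) hle z k hk
    · rw [norm_sub_rev, abs_sub_comm]
      exact hTL hcl hI' (-1) (by norm_num) τ (by linarith) hle z k hk
  -- uniform bounds and time-Lipschitz bounds of `ω', u', ∇u', ∇ω', Δω'` at `z` on the window
  have hwB : ∀ s, |s - (-1)| ≤ 1 / 2 → ‖w s‖ ≤ M₀ := fun s hs => by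
    obtain ⟨hs4, -, -, -⟩ := hwin s hs
    rw [hω, hM₀]
    dsimp only
    rw [curl_eq_curlCLM, hc]
    exact (ContinuousLinearMap.le_opNorm _ _).trans (mul_le_mul_of_nonneg_left
      (norm_fderiv_le_of_dist_le hK ((hKL hcl hI').1 s hs4) z) (norm_nonneg _))
  have hwL : ∀ s, |s - (-1)| ≤ 1 / 2 → ‖w s - w (-1)‖ ≤ c * L * |s - (-1)| := fun s hs => by
    rw [hω, hc]
    dsimp only
    rw [curl_eq_curlCLM, curl_eq_curlCLM, ← map_sub, mul_assoc]
    refine (ContinuousLinearMap.le_opNorm _ _).trans (mul_le_mul_of_nonneg_left ?_ (norm_nonneg _))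
    rw [norm_fderiv_sub_eq_norm_iteratedFDeriv_one_sub]
    exact hTL' s (-1) hs h1e 1 (by norm_num)
  have huB : ∀ s, |s - (-1)| ≤ 1 / 2 → ‖v s z‖ ≤ 2 * C₀ := fun s hs =>
    ChaeWolf.typeI_norm_le_two_mul hC₀ hI' (hwin s hs).1 z
  have huL : ∀ s, |s - (-1)| ≤ 1 / 2 →
      ‖v s z - v (-1) z‖ ≤ L * |s - (-1)| := fun s hs => by
    rw [norm_sub_eq_norm_iteratedFDeriv_zero_sub]
    exact hTL' s (-1) hs h1e 0 (by norm_num)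
  have hDuB : ∀ s, |s - (-1)| ≤ 1 / 2 → ‖fderiv ℝ (v s) z‖ ≤ K := fun s hs =>
    norm_fderiv_le_of_dist_le hK ((hKL hcl hI').1 s (hwin s hs).1) z
  have hDuL : ∀ s, |s - (-1)| ≤ 1 / 2 →
      ‖fderiv ℝ (v s) z - fderiv ℝ (v (-1)) z‖ ≤ L * |s - (-1)| := fun s hs => by
    rw [norm_fderiv_sub_eq_norm_iteratedFDeriv_one_sub]
    exact hTL' s (-1) hs h1e 1 (by norm_num)
  have hDwB : ∀ s, |s - (-1)| ≤ 1 / 2 → ‖fderiv ℝ (curl (v s)) z‖ ≤ c * K₂' := fun s hs => by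
    obtain ⟨hs4, hs0, -, -⟩ := hwin s hs
    rw [hDcurl s hs0, hc]
    exact (ContinuousLinearMap.opNorm_comp_le _ _).trans
      (mul_le_mul_of_nonneg_left ((hH hcl hI').1 s hs4 z) (norm_nonneg _))
  have hDwL : ∀ s, |s - (-1)| ≤ 1 / 2 → ‖fderiv ℝ (curl (v s)) z -
      fderiv ℝ (curl (v (-1))) z‖ ≤ c * L * |s - (-1)| := fun s hs => by
    obtain ⟨hs4, hs0, -, -⟩ := hwin s hs
    rw [hDcurl s hs0, hDcurl (-1) (by norm_num), ← ContinuousLinearMap.comp_sub, hc, mul_assoc]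
    refine (ContinuousLinearMap.opNorm_comp_le _ _).trans (mul_le_mul_of_nonneg_left ?_ (norm_nonneg _))
    rw [norm_fderiv_fderiv_sub_eq]
    exact hTL' s (-1) hs h1e 2 (by norm_num)
  have hΔB : ∀ s, |s - (-1)| ≤ 1 / 2 → ‖(Δ (curl (v s))) z‖ ≤ 12 * K₃ := fun s hs => by
    obtain ⟨hs4, hs0, -, -⟩ := hwin s hs
    calc ‖(Δ (curl (v s))) z‖ ≤ 3 * ‖iteratedFDeriv ℝ 2 (curl (v s)) z‖ :=
          norm_laplacian_le_three_mul _ _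
      _ ≤ 3 * (4 * ‖iteratedFDeriv ℝ 3 (v s) z‖) := by
          gcongr; exact norm_iteratedFDeriv_curl_le_four_mul (hcd s hs0) 2 z
      _ ≤ 3 * (4 * K₃) := by gcongr; exact hD3 hcl hI' s hs4 z
      _ = 12 * K₃ := by ring
  have hΔL : ∀ s, |s - (-1)| ≤ 1 / 2 → ‖(Δ (curl (v s))) z -
      (Δ (curl (v (-1)))) z‖ ≤ 12 * L * |s - (-1)| := fun s hs => by
    obtain ⟨hs4, hs0, -, -⟩ := hwin s hs
    have h10 : (-1:ℝ) < 0 := by norm_num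
    have hcs : ∀ τ : ℝ, τ < 0 → ContDiff ℝ ∞ (curl (v τ)) := fun τ hτ =>
      contDiff_curl (n := ⊤) ((hcd τ hτ).of_le (by exact_mod_cast (le_top : (⊤ + 1 : ℕ∞) ≤ ⊤)))
    have hd : ∀ τ : ℝ, τ < 0 → Differentiable ℝ (v τ) := fun τ hτ =>
      (hcd τ hτ).differentiable (by norm_cast)
    have h1 : ContDiff ℝ ∞ (v s - v (-1)) := (hcd s hs0).sub (hcd (-1) h10)
    rw [← ContDiffAt.laplacian_sub ((hcs s hs0).of_le (by norm_cast)).contDiffAt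
        ((hcs (-1) h10).of_le (by norm_cast)).contDiffAt, ← curl_sub' (hd s hs0) (hd (-1) h10)]
    calc ‖(Δ (curl (v s - v (-1)))) z‖
        ≤ 3 * ‖iteratedFDeriv ℝ 2 (curl (v s - v (-1))) z‖ :=
          norm_laplacian_le_three_mul _ _
      _ ≤ 3 * (4 * ‖iteratedFDeriv ℝ 3 (v s - v (-1)) z‖) := by
          gcongr; exact norm_iteratedFDeriv_curl_le_four_mul h1 2 z
      _ = 12 * ‖iteratedFDeriv ℝ 3 (v s) z - iteratedFDeriv ℝ 3 (v (-1)) z‖ := by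
          rw [iteratedFDeriv_sub_apply ((hcd s hs0).of_le (by norm_cast)).contDiffAt
              ((hcd (-1) h10).of_le (by norm_cast)).contDiffAt]
          ring
      _ ≤ 12 * (L * |s - (-1)|) := by gcongr; exact hTL' s (-1) hs h1e 3 (by norm_num)
      _ = 12 * L * |s - (-1)| := by ring
  -- the time derivative `V = ∂ₜω'(·,z)`: bounded and Lipschitz at `-1` on the window
  have hwB' : ∀ s, |s - (-1)| ≤ 1 / 2 → ‖curl (v s) z‖ ≤ M₀ := fun s hs => by
    have h := hwB s hs
    rw [hω] at h
    exact h
  have hwL' : ∀ s, |s - (-1)| ≤ 1 / 2 →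
      ‖curl (v s) z - curl (v (-1)) z‖ ≤ c * L * |s - (-1)| := fun s hs => by
    have h := hwL s hs
    rw [hω] at h
    exact h
  have hVB : ∀ s, |s - (-1)| ≤ 1 / 2 → ‖V s‖ ≤ V₀ := fun s hs => by
    obtain ⟨hs4, hs0, -, -⟩ := hwin s hs
    rw [hVval s hs0, hV₀]
    have h1 : ‖fderiv ℝ (curl (v s)) z (v s z)‖ ≤ c * K₂' * (2 * C₀) :=
      (ContinuousLinearMap.le_opNorm _ _).trans
        (mul_le_mul (hDwB s hs) (huB s hs) (norm_nonneg _) (by positivity))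
    have h2 : ‖fderiv ℝ (v s) z (curl (v s) z)‖ ≤ K * M₀ :=
      (ContinuousLinearMap.le_opNorm _ _).trans (mul_le_mul (hDuB s hs) (hwB' s hs) (norm_nonneg _) hK)
    have h3 := norm_add_le ((Δ (curl (v s))) z -
      fderiv ℝ (curl (v s)) z (v s z))
      (fderiv ℝ (v s) z (curl (v s) z))
    have h4 := norm_sub_le ((Δ (curl (v s))) z)
      (fderiv ℝ (curl (v s)) z (v s z))
    exact h3.trans (add_le_add (h4.trans (add_le_add (hΔB s hs) h1)) h2)
  have hVL : ∀ s, |s - (-1)| ≤ 1 / 2 → ‖V s - V (-1)‖ ≤ LV * |s - (-1)| := fun s hs => by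
    obtain ⟨hs4, hs0, -, -⟩ := hwin s hs
    have hab : 0 ≤ |s - (-1)| := abs_nonneg _
    -- the transport term
    have hA : ‖fderiv ℝ (curl (v s)) z (v s z) -
        fderiv ℝ (curl (v (-1))) z (v (-1) z)‖ ≤
        (c * L * (2 * C₀) + c * K₂' * L) * |s - (-1)| := by
      have e : fderiv ℝ (curl (v s)) z (v s z) -
          fderiv ℝ (curl (v (-1))) z (v (-1) z) =
          (fderiv ℝ (curl (v s)) z - fderiv ℝ (curl (v (-1))) z)
            (v s z) +
          fderiv ℝ (curl (v (-1))) z (v s z - v (-1) z) := by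
        have r1 : (fderiv ℝ (curl (v s)) z - fderiv ℝ (curl (v (-1))) z)
            (v s z) = fderiv ℝ (curl (v s)) z (v s z) -
            fderiv ℝ (curl (v (-1))) z (v s z) := rfl
        rw [r1, map_sub]; abel
      rw [e]
      have h1 := (ContinuousLinearMap.le_opNorm _ (v s z)).trans
        (mul_le_mul (hDwL s hs) (huB s hs) (norm_nonneg _) (by positivity))
      have h2 := (ContinuousLinearMap.le_opNorm _ (v s z - v (-1) z)).trans
        (mul_le_mul (hDwB (-1) h1') (huL s hs) (norm_nonneg _) (by positivity))
      have h3 := norm_add_le ((fderiv ℝ (curl (v s)) z -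
        fderiv ℝ (curl (v (-1))) z) (v s z))
        (fderiv ℝ (curl (v (-1))) z (v s z - v (-1) z))
      have e2 : c * L * |s - (-1)| * (2 * C₀) + c * K₂' * (L * |s - (-1)|) =
          (c * L * (2 * C₀) + c * K₂' * L) * |s - (-1)| := by ring
      exact h3.trans ((add_le_add h1 h2).trans (le_of_eq e2))
    -- the stretching term
    have hB : ‖fderiv ℝ (v s) z (curl (v s) z) -
        fderiv ℝ (v (-1)) z (curl (v (-1)) z)‖ ≤
        (L * M₀ + K * (c * L)) * |s - (-1)| := by
      have e : fderiv ℝ (v s) z (curl (v s) z) -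
          fderiv ℝ (v (-1)) z (curl (v (-1)) z) =
          (fderiv ℝ (v s) z - fderiv ℝ (v (-1)) z) (curl (v s) z) +
          fderiv ℝ (v (-1)) z (curl (v s) z - curl (v (-1)) z) := by
        have r1 : (fderiv ℝ (v s) z - fderiv ℝ (v (-1)) z) (curl (v s) z) =
            fderiv ℝ (v s) z (curl (v s) z) -
            fderiv ℝ (v (-1)) z (curl (v s) z) := rfl
        rw [r1, map_sub]; abel
      rw [e]
      have h1 := (ContinuousLinearMap.le_opNorm _ (curl (v s) z)).trans
        (mul_le_mul (hDuL s hs) (hwB' s hs) (norm_nonneg _) (by positivity))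
      have h2 := (ContinuousLinearMap.le_opNorm _
        (curl (v s) z - curl (v (-1)) z)).trans
        (mul_le_mul (hDuB (-1) h1') (hwL' s hs) (norm_nonneg _) hK)
      have h3 := norm_add_le ((fderiv ℝ (v s) z - fderiv ℝ (v (-1)) z)
        (curl (v s) z))
        (fderiv ℝ (v (-1)) z (curl (v s) z - curl (v (-1)) z))
      have e2 : L * |s - (-1)| * M₀ + K * (c * L * |s - (-1)|) = (L * M₀ + K * (c * L)) * |s - (-1)| := by
        ring
      exact h3.trans ((add_le_add h1 h2).trans (le_of_eq e2))
    rw [hVval s hs0, hVval (-1) (by norm_num), hLV]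
    have e : (Δ (curl (v s))) z - fderiv ℝ (curl (v s)) z (v s z) +
        fderiv ℝ (v s) z (curl (v s) z) -
        ((Δ (curl (v (-1)))) z -
          fderiv ℝ (curl (v (-1))) z (v (-1) z) +
          fderiv ℝ (v (-1)) z (curl (v (-1)) z)) =
        ((Δ (curl (v s))) z - (Δ (curl (v (-1)))) z) -
        (fderiv ℝ (curl (v s)) z (v s z) -
          fderiv ℝ (curl (v (-1))) z (v (-1) z)) +
        (fderiv ℝ (v s) z (curl (v s) z) -
          fderiv ℝ (v (-1)) z (curl (v (-1)) z)) := by abel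
    rw [e]
    have h3 := norm_add_le (((Δ (curl (v s))) z - (Δ (curl (v (-1)))) z) -
        (fderiv ℝ (curl (v s)) z (v s z) -
          fderiv ℝ (curl (v (-1))) z (v (-1) z)))
        (fderiv ℝ (v s) z (curl (v s) z) -
          fderiv ℝ (v (-1)) z (curl (v (-1)) z))
    have h4 := norm_sub_le ((Δ (curl (v s))) z - (Δ (curl (v (-1)))) z)
        (fderiv ℝ (curl (v s)) z (v s z) -
          fderiv ℝ (curl (v (-1))) z (v (-1) z))
    have e2 : 12 * L * |s - (-1)| + (c * L * (2 * C₀) + c * K₂' * L) * |s - (-1)| +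
        (L * M₀ + K * (c * L)) * |s - (-1)| =
        (12 * L + (c * L * (2 * C₀) + c * K₂' * L) + (L * M₀ + K * (c * L))) * |s - (-1)| := by ring
    exact h3.trans ((add_le_add (h4.trans (add_le_add (hΔL s hs) hA)) hB).trans (le_of_eq e2))
  -- the scalar ingredients of `Γ`
  have hqL : ∀ s, |s - (-1)| ≤ 1 / 2 → |‖w s‖ ^ 2 - ‖w (-1)‖ ^ 2| ≤ 2 * M₀ * (c * L) * |s - (-1)| :=
    fun s hs => by
      have h1 : |‖w s‖ - ‖w (-1)‖| ≤ c * L * |s - (-1)| := (abs_norm_sub_norm_le _ _).trans (hwL s hs)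
      have h2 : ‖w s‖ + ‖w (-1)‖ ≤ 2 * M₀ := by linarith [hwB s hs, hwB (-1) h1']
      rw [show ‖w s‖ ^ 2 - ‖w (-1)‖ ^ 2 = (‖w s‖ - ‖w (-1)‖) * (‖w s‖ + ‖w (-1)‖) by ring, abs_mul,
        abs_of_nonneg (by positivity : 0 ≤ ‖w s‖ + ‖w (-1)‖)]
      calc |‖w s‖ - ‖w (-1)‖| * (‖w s‖ + ‖w (-1)‖) ≤ (c * L * |s - (-1)|) * (2 * M₀) :=
            mul_le_mul h1 h2 (by positivity) (by positivity)
        _ = 2 * M₀ * (c * L) * |s - (-1)| := by ring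
  have hιB : ∀ s, |s - (-1)| ≤ 1 / 2 → |⟪w s, V s⟫| ≤ M₀ * V₀ := fun s hs =>
    (abs_real_inner_le_norm _ _).trans (mul_le_mul (hwB s hs) (hVB s hs) (norm_nonneg _) hM₀0)
  have hιL : ∀ s, |s - (-1)| ≤ 1 / 2 →
      |⟪w s, V s⟫ - ⟪w (-1), V (-1)⟫| ≤ (c * L * V₀ + M₀ * LV) * |s - (-1)| := fun s hs => by
    have e : ⟪w s, V s⟫ - ⟪w (-1), V (-1)⟫ = ⟪w s - w (-1), V s⟫ + ⟪w (-1), V s - V (-1)⟫ := by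
      rw [inner_sub_left, inner_sub_right]; ring
    rw [e]
    have h1 := (abs_real_inner_le_norm (w s - w (-1)) (V s)).trans
      (mul_le_mul (hwL s hs) (hVB s hs) (norm_nonneg _) (by positivity))
    have h2 := (abs_real_inner_le_norm (w (-1)) (V s - V (-1))).trans
      (mul_le_mul (hwB (-1) h1') (hVL s hs) (norm_nonneg _) hM₀0)
    have h3 := abs_add_le ⟪w s - w (-1), V s⟫ ⟪w (-1), V s - V (-1)⟫
    have e2 : c * L * |s - (-1)| * V₀ + M₀ * (LV * |s - (-1)|) = (c * L * V₀ + M₀ * LV) * |s - (-1)| := by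
      ring
    linarith
  -- `Γ` is Lipschitz at `-1` on the window, and bounded at `-1`
  have hΓL : ∀ s, |s - (-1)| ≤ 1 / 2 → |Γ s - Γ (-1)| ≤ LΓ * |s - (-1)| := fun s hs => by
    obtain ⟨hs4, hs0, hs5, hs6⟩ := hwin s hs
    have hab : 0 ≤ |s - (-1)| := abs_nonneg _
    obtain ⟨T₁, hT₁⟩ : ∃ T₁ : ℝ, T₁ = (0 - s) * ‖w s‖ ^ 2 - (0 - (-1:ℝ)) * ‖w (-1)‖ ^ 2 := ⟨_, rfl⟩
    obtain ⟨T₂, hT₂⟩ : ∃ T₂ : ℝ,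
        T₂ = (0 - s) ^ 2 * (2 * ⟪w s, V s⟫) - (0 - (-1:ℝ)) ^ 2 * (2 * ⟪w (-1), V (-1)⟫) := ⟨_, rfl⟩
    have hT1 : |T₁| ≤ (M₀ ^ 2 + 2 * M₀ * (c * L)) * |s - (-1)| := by
      have e : T₁ = (-(s - (-1))) * ‖w s‖ ^ 2 + (‖w s‖ ^ 2 - ‖w (-1)‖ ^ 2) := by rw [hT₁]; ring
      rw [e]
      have h1 : |(-(s - (-1))) * ‖w s‖ ^ 2| ≤ |s - (-1)| * M₀ ^ 2 := by
        rw [abs_mul, abs_neg, abs_of_nonneg (by positivity : (0:ℝ) ≤ ‖w s‖ ^ 2)]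
        exact mul_le_mul_of_nonneg_left (pow_le_pow_left₀ (norm_nonneg _) (hwB s hs) 2) (abs_nonneg _)
      have h2 := hqL s hs
      have h3 := abs_add_le ((-(s - (-1))) * ‖w s‖ ^ 2) (‖w s‖ ^ 2 - ‖w (-1)‖ ^ 2)
      have e2 : |s - (-1)| * M₀ ^ 2 + 2 * M₀ * (c * L) * |s - (-1)| =
          (M₀ ^ 2 + 2 * M₀ * (c * L)) * |s - (-1)| := by ring
      exact h3.trans ((add_le_add h1 h2).trans (le_of_eq e2))
    have hT2 : |T₂| ≤ 2 * ((5 / 2) * (M₀ * V₀) + (c * L * V₀ + M₀ * LV)) * |s - (-1)| := by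
      have e : T₂ = 2 * (((s - (-1)) * (s - 1)) * ⟪w s, V s⟫ + (⟪w s, V s⟫ - ⟪w (-1), V (-1)⟫)) := by
        rw [hT₂]; ring
      rw [e, abs_mul, abs_two]
      have h1 : |((s - (-1)) * (s - 1)) * ⟪w s, V s⟫| ≤ (|s - (-1)| * (5 / 2)) * (M₀ * V₀) := by
        rw [abs_mul, abs_mul]
        refine mul_le_mul (mul_le_mul_of_nonneg_left ?_ (abs_nonneg _)) (hιB s hs) (abs_nonneg _)
          (by positivity)
        rw [abs_le]; constructor <;> linarith
      have h2 := hιL s hs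
      have h3 := abs_add_le (((s - (-1)) * (s - 1)) * ⟪w s, V s⟫) (⟪w s, V s⟫ - ⟪w (-1), V (-1)⟫)
      have e2 : 2 * ((|s - (-1)| * (5 / 2)) * (M₀ * V₀) + (c * L * V₀ + M₀ * LV) * |s - (-1)|) =
          2 * ((5 / 2) * (M₀ * V₀) + (c * L * V₀ + M₀ * LV)) * |s - (-1)| := by ring
      exact (mul_le_mul_of_nonneg_left (h3.trans (add_le_add h1 h2)) zero_le_two).trans (le_of_eq e2)
    have key : Γ s - Γ (-1) = (-2) * T₁ + T₂ := by
      rw [hΓdef, hT₁, hT₂]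
      ring
    rw [key, hLΓ]
    have h3 := abs_add_le ((-2) * T₁) T₂
    rw [abs_mul, show |(-2:ℝ)| = 2 by norm_num] at h3
    have e2 : 2 * ((M₀ ^ 2 + 2 * M₀ * (c * L)) * |s - (-1)|) +
        2 * ((5 / 2) * (M₀ * V₀) + (c * L * V₀ + M₀ * LV)) * |s - (-1)| =
        (2 * (M₀ ^ 2 + 2 * M₀ * (c * L)) + 2 * ((5 / 2) * (M₀ * V₀) + (c * L * V₀ + M₀ * LV))) *
          |s - (-1)| := by ring
    exact h3.trans ((add_le_add (mul_le_mul_of_nonneg_left hT1 zero_le_two) hT2).trans (le_of_eq e2))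
  have hΓC : |Γ (-1)| ≤ CΓ := by
    have key : Γ (-1) = -2 * ‖w (-1)‖ ^ 2 + 2 * ⟪w (-1), V (-1)⟫ := by
      rw [hΓdef]
      ring
    rw [key, hCΓ]
    have h1 : |-2 * ‖w (-1)‖ ^ 2| ≤ 2 * M₀ ^ 2 := by
      rw [abs_mul, show |(-2:ℝ)| = 2 by norm_num, abs_of_nonneg (by positivity : (0:ℝ) ≤ ‖w (-1)‖ ^ 2)]
      exact mul_le_mul_of_nonneg_left (pow_le_pow_left₀ (norm_nonneg _) (hwB (-1) h1') 2) zero_le_two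
    have h2 : |2 * ⟪w (-1), V (-1)⟫| ≤ 2 * (M₀ * V₀) := by
      rw [abs_mul, abs_two]
      exact mul_le_mul_of_nonneg_left (hιB (-1) h1') zero_le_two
    exact (abs_add_le _ _).trans (add_le_add h1 h2)
  -- export in the stated (definition-free) form
  refine ⟨fun s hs => ?_, ?_⟩
  · have h := hΓL s hs
    rw [hΓdef, hω, hV] at h
    exact h
  · have h := hΓC
    rw [hΓdef, hω, hV] at h
    exact h

end Summit.NavierStokesRegularity.NavierStokesRegularity.Theorems.StrainDoors
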